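import Mathlib
import HarnessLib
import Summits.HubbardSuperconductivity.HubbardSuperconductivity.Theses.KLProgramme
import Literature.Analysis.Complex.VitaliConvergence
import Literature.MathematicalPhysics.QuantumLattice.HubbardTorusTwoPointSmallCoupling

/-!
# Route `KLProgramme` — crux K1 `H10TwoPointLimit` (stmt-HubbardSuperconductivity-19938): the VITALI LINE
# (K1 from ONE analytic input — `L`-uniformly bounded holomorphic extensions of the finite-volume two-point functions to a connected
# complex neighbourhood of the admissible real couplings containing `0` — bypassing the termwise volume-limit / two-point-assembly
# children 4 + 5 of K3)

Seat leafhand-hubbard-klprogramme-2 (K1 lead, 2026-08-30).  THE OBSERVATION.  The tree PROVES the convergence of the finite-volume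
two-point functions `L ↦ ⟨c†_{xσ} c_{yσ'}⟩_{β,L,U,μ}` for all REAL `|U| < r(β, μ)` (the bare single-scale corner
`hubbardTwoPoint_limit_exists_of_small_coupling`, `…HubbardTorusTwoPointSmallCoupling`).  If for `L ≥ L₀` the two-point function is the
real trace of a holomorphic `G_L` on an open connected `Ω ∋ 0`, the family `(G_L)` locally uniformly bounded on `Ω` uniformly in `L`, then
by VITALI's theorem (`Literature.Analysis.Complex.exists_tendstoLocallyUniformlyOn_of_frequently_tendsto`: Montel + the identity theorem +
the subsequence principle) the convergence PROPAGATES from the small real couplings — which accumulate at `0 ∈ Ω` — to all of `Ω`, in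
particular to every admissible real coupling inside `Ω`.  This is the shape of the tree's R0 core (`…H10RungBetaUCorner.R0_core`: such
extensions on the DISC `|u| < κ/β`, which contains K1's couplings only in the corner `βU ≤ κ`); the Vitali line asks for them on a
connected NEIGHBOURHOOD of the real segment `[0, U₀ ∧ a/log β]` instead (a «sausage» of width `O(1/β)`, what a multiscale expansion at
complex coupling can give — a disc about `0` of radius `> U` is not to be expected at fixed `μ` beyond `O(1/β)`, the Hartree shift).

* `tendstoLocallyUniformlyOn_of_connected_extension` — `β > 0`: holomorphic `G_L` on an open preconnected `Ω ∋ 0`, locally uniformly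
  bounded uniformly in `L ≥ L₀`, agreeing with the two-point function at the real points of `Ω` ⟹ `G_{k+L₀} → f` locally uniformly on `Ω`;
* `tendsto_hubbardThermalTwoPoint_of_connected_extension` — hence the thermodynamic limit exists at EVERY real `U` with `(U : ℂ) ∈ Ω`;
  `…_of_connected_bound` — the corollary with one global bound `‖G_L‖ ≤ B` on `Ω`;
* `limit_of_sausage_input` — packaging for an arbitrary admissibility predicate `A β U` on a `μ`-window;
* **`H10TwoPointLimit_of_complexSausage`** — crux K1 from the ONE remaining analytic input on the analysis window `μ ∈ [-1, -0.15]`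
  (S0 `MuOfDopingWindow_holds` places `μ(δ)`): `∃ U₀ a > 0`, for every `μ` in the window, `β > 0`, sites/spins: an open preconnected
  `Ω ∋ 0` containing every admissible real coupling (`0 < U ≤ U₀`, `β ≤ e^{a/U}`), `L₀`, `B` and holomorphic `G_L` (`L ≥ L₀`) bounded by `B`
  on `Ω` with real trace the two-point function;
* `leaf_of_complexSausage` — the same for the rung-R2d leaf `H1TwoPointLimitKLScaleD` (admissible = `U ≤ U₀`, `β ≤ e^{c/U²}`).

WHY THIS IS A LINE.  The route's children 4 + 5 (two-point assembly; termwise volume limits of the last-scale kernel — item 23356 OPEN with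
two engine-export atoms) build `S = lim_L` from the explicit structure of the renormalised expansion; the Vitali line needs NO termwise
limit and NO `U`-power series at the target coupling.  What remains for K1 on this line is ONE statement: the `L`-uniform complex-coupling
bound on a sausage reaching `U₀` at `|U| log β ≤ a` (BGM 2006 Thm 2.1 / §3 at intermediate filling, run at complex coupling with
`|Im u| ≲ 1/β`).  Everything here is PROVED; no definition, no named fact; nothing asserts that input or anything about the Hubbard model
beyond the CLOSED theorems cited.  References: BGM 2006 [cite: BenfattoGiulianiMastropietro2006, Thm 1.1, §2.2 footnote 1];
Vitali–Porter (Titchmarsh, The Theory of Functions, §5.21) [folklore].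
-/

noncomputable section

namespace Summit.HubbardSuperconductivity.HubbardSuperconductivity.Theorems.H10VitaliLine

set_option linter.dupNamespace false -- summit = problem name (single-conjunct summit), D-0017

open Filter Set Metric Topology Complex
open Literature.MathematicalPhysics.QuantumLattice Literature.Probability.LatticeModels

/-! ## §1 Vitali: convergence at every real coupling of a connected domain of `L`-uniform analyticity containing `0` -/

/-- Real couplings `r/(m+2)`, `m : ℕ`, tend to `0` WITHIN the punctured neighbourhood filter of `0 ∈ ℂ`. [folklore] -/
theorem tendsto_real_seq_nhdsWithin_zero {r : ℝ} (hr : 0 < r) :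
    Tendsto (fun m : ℕ => (((r / ((m : ℝ) + 2) : ℝ)) : ℂ)) atTop (𝓝[≠] (0 : ℂ)) := by
  apply tendsto_nhdsWithin_of_tendsto_nhds_of_eventually_within
  · have h1 : Tendsto (fun m : ℕ => (r / ((m : ℝ) + 2) : ℝ)) atTop (𝓝 0) := by
      apply Tendsto.div_atTop tendsto_const_nhds
      exact tendsto_atTop_add_const_right _ _ tendsto_natCast_atTop_atTop
    have h2 := (Complex.continuous_ofReal.tendsto 0).comp h1
    simpa only [Function.comp_def, Complex.ofReal_zero] using h2
  · refine Eventually.of_forall fun m => ?_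
    have hm : (0 : ℝ) < (m : ℝ) + 2 := by positivity
    have hne : (r / ((m : ℝ) + 2) : ℝ) ≠ 0 := (div_pos hr hm).ne'
    simp only [mem_compl_iff, mem_singleton_iff]
    exact fun h => hne (Complex.ofReal_eq_zero.1 h)

/-- **Vitali for holomorphic extensions of the finite-volume two-point functions**: for `β > 0`, if `Ω` is open and preconnected with
`0 ∈ Ω`, and for `L ≥ L₀` there are `G_L : ℂ → ℂ` complex differentiable on `Ω`, locally uniformly bounded there uniformly in `L`, whose
real trace on `Ω` is `U ↦ ⟨c†_{xσ} c_{yσ'}⟩_{β,L,U,μ}`, then the shifted family `G_{k+L₀}` converges LOCALLY UNIFORMLY on `Ω` to a holomorphic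
function — the pointwise convergence at the real couplings `|U| < r(β, μ)` of the tree's bare corner (which accumulate at `0 ∈ Ω`)
propagates by the identity theorem. [folklore: Vitali–Porter] -/
theorem tendstoLocallyUniformlyOn_of_connected_extension {β : ℝ} (hβ : 0 < β) (μ : ℝ) (x y : Site 2) (σ σ' : Fin 2)
    {Ω : Set ℂ} (hΩ : IsOpen Ω) (hΩc : IsPreconnected Ω) (h0 : (0 : ℂ) ∈ Ω) {G : ℕ → ℂ → ℂ} {L₀ : ℕ}
    (hd : ∀ L, L₀ ≤ L → DifferentiableOn ℂ (G L) Ω)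
    (hb : ∀ a ∈ Ω, ∃ M : ℝ, ∃ ρ > 0, ∀ L, L₀ ≤ L → ∀ z ∈ ball a ρ ∩ Ω, ‖G L z‖ ≤ M)
    (hagree : ∀ L, L₀ ≤ L → ∀ U : ℝ, ((U : ℝ) : ℂ) ∈ Ω → G L (U : ℂ) = hubbardThermalTwoPoint β U μ L x y σ σ') :
    ∃ f : ℂ → ℂ, DifferentiableOn ℂ f Ω ∧ TendstoLocallyUniformlyOn (fun k : ℕ => G (k + L₀)) f atTop Ω := by
  -- the shifted family
  set F : ℕ → ℂ → ℂ := fun k => G (k + L₀) with hF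
  have hF' : ∀ k, DifferentiableOn ℂ (F k) Ω := fun k => hd (k + L₀) (Nat.le_add_left _ _)
  have hb' : ∀ a ∈ Ω, ∃ M : ℝ, ∃ ρ > 0, ∀ k, ∀ z ∈ ball a ρ ∩ Ω, ‖F k z‖ ≤ M := by
    intro a ha
    obtain ⟨M, ρ, hρ, hM⟩ := hb a ha
    exact ⟨M, ρ, hρ, fun k z hz => hM (k + L₀) (Nat.le_add_left _ _) z hz⟩
  -- a small ball about `0` inside `Ω`
  obtain ⟨ε, hε, hball⟩ := Metric.isOpen_iff.1 hΩ 0 h0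
  -- pointwise convergence at the small real couplings of the bare corner, accumulating at `0`
  obtain ⟨r, hr, hconv⟩ := hubbardTwoPoint_limit_exists_of_small_coupling hβ μ
  have hr' : 0 < min r ε := lt_min hr hε
  have hS : ∃ᶠ z in 𝓝[≠] (0 : ℂ), ∃ c : ℂ, Tendsto (fun k => F k z) atTop (𝓝 c) := by
    refine (tendsto_real_seq_nhdsWithin_zero hr').frequently (Eventually.of_forall fun m => ?_).frequently
    have hm : (0 : ℝ) < (m : ℝ) + 2 := by positivity
    set Um : ℝ := min r ε / ((m : ℝ) + 2) with hUm_def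
    have hUm0 : 0 < Um := div_pos hr' hm
    have hUm_lt : Um < min r ε := by
      rw [hUm_def, div_lt_iff₀ hm]
      nlinarith
    have hUr : |Um| < r := by rw [abs_of_pos hUm0]; exact hUm_lt.trans_le (min_le_left _ _)
    have hUΩ : ((Um : ℝ) : ℂ) ∈ Ω := by
      apply hball
      rw [Metric.mem_ball, dist_zero_right, Complex.norm_real, Real.norm_eq_abs, abs_of_pos hUm0]
      exact hUm_lt.trans_le (min_le_right _ _)
    obtain ⟨S, hS⟩ := hconv _ hUr x y σ σ'
    refine ⟨S, ?_⟩
    have h2 := hS.comp (tendsto_add_atTop_nat L₀)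
    refine h2.congr fun k => ?_
    simp only [hF, Function.comp]
    exact (hagree (k + L₀) (Nat.le_add_left _ _) Um hUΩ).symm
  exact Literature.Analysis.Complex.exists_tendstoLocallyUniformlyOn_of_frequently_tendsto hΩ hΩc hF' hb' h0 hS

/-- **The thermodynamic limit at every real coupling of a connected domain of `L`-uniform analyticity containing `0`**: under the
hypotheses of `tendstoLocallyUniformlyOn_of_connected_extension`, for every REAL `U` with `(U : ℂ) ∈ Ω` the finite-volume thermal
two-point functions `⟨c†_{xσ} c_{yσ'}⟩_{β,L,U,μ}` converge as `L → ∞`. [folklore: Vitali–Porter] -/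
theorem tendsto_hubbardThermalTwoPoint_of_connected_extension {β : ℝ} (hβ : 0 < β) (μ : ℝ) (x y : Site 2) (σ σ' : Fin 2)
    {Ω : Set ℂ} (hΩ : IsOpen Ω) (hΩc : IsPreconnected Ω) (h0 : (0 : ℂ) ∈ Ω) {G : ℕ → ℂ → ℂ} {L₀ : ℕ}
    (hd : ∀ L, L₀ ≤ L → DifferentiableOn ℂ (G L) Ω)
    (hb : ∀ a ∈ Ω, ∃ M : ℝ, ∃ ρ > 0, ∀ L, L₀ ≤ L → ∀ z ∈ ball a ρ ∩ Ω, ‖G L z‖ ≤ M)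
    (hagree : ∀ L, L₀ ≤ L → ∀ U : ℝ, ((U : ℝ) : ℂ) ∈ Ω → G L (U : ℂ) = hubbardThermalTwoPoint β U μ L x y σ σ')
    {U : ℝ} (hU : ((U : ℝ) : ℂ) ∈ Ω) :
    ∃ S : ℂ, Tendsto (fun L : ℕ => hubbardThermalTwoPoint β U μ L x y σ σ') atTop (𝓝 S) := by
  obtain ⟨f, -, hlim⟩ := tendstoLocallyUniformlyOn_of_connected_extension hβ μ x y σ σ' hΩ hΩc h0 hd hb hagree
  refine ⟨f U, ?_⟩
  rw [← tendsto_add_atTop_iff_nat L₀]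
  refine (hlim.tendsto_at hU).congr fun k => ?_
  exact hagree (k + L₀) (Nat.le_add_left _ _) U hU

/-- **Corollary with one global bound**: `Ω` open, preconnected, `0 ∈ Ω`; for `L ≥ L₀`, `G_L` holomorphic on `Ω`, `‖G_L‖ ≤ B` there, real
trace the two-point function ⟹ the limit exists at every real `U` with `(U : ℂ) ∈ Ω`. [folklore: Vitali–Porter] -/
theorem tendsto_hubbardThermalTwoPoint_of_connected_bound {β : ℝ} (hβ : 0 < β) (μ : ℝ) (x y : Site 2) (σ σ' : Fin 2)
    {Ω : Set ℂ} (hΩ : IsOpen Ω) (hΩc : IsPreconnected Ω) (h0 : (0 : ℂ) ∈ Ω) {G : ℕ → ℂ → ℂ} {L₀ : ℕ} {B : ℝ}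
    (hd : ∀ L, L₀ ≤ L → DifferentiableOn ℂ (G L) Ω) (hB : ∀ L, L₀ ≤ L → ∀ z ∈ Ω, ‖G L z‖ ≤ B)
    (hagree : ∀ L, L₀ ≤ L → ∀ U : ℝ, ((U : ℝ) : ℂ) ∈ Ω → G L (U : ℂ) = hubbardThermalTwoPoint β U μ L x y σ σ')
    {U : ℝ} (hU : ((U : ℝ) : ℂ) ∈ Ω) :
    ∃ S : ℂ, Tendsto (fun L : ℕ => hubbardThermalTwoPoint β U μ L x y σ σ') atTop (𝓝 S) :=
  tendsto_hubbardThermalTwoPoint_of_connected_extension hβ μ x y σ σ' hΩ hΩc h0 hd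
    (fun _ _ => ⟨B, 1, one_pos, fun L hL z hz => hB L hL z hz.2⟩) hagree hU

/-! ## §2 K1 and the leaf from the ONE analytic input (the complex sausage) -/

/-- **The analytic input of the Vitali line on a `μ`-window for an admissibility predicate `A β U`** (e.g. K1's `0 < U ≤ U₀ ∧ β ≤ e^{a/U}`)
gives the limit at every admissible coupling: for every `μ` in the window, `β > 0`, sites and spins there are an open preconnected `Ω ∋ 0`
containing `(U : ℂ)` for every admissible real `U`, a threshold `L₀`, a bound `B` and holomorphic `G_L` (`L ≥ L₀`) bounded by `B` on `Ω` whose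
real trace on `Ω` is the finite-volume two-point function. [folklore: composition] -/
theorem limit_of_sausage_input {μa μb : ℝ} {A : ℝ → ℝ → Prop}
    (h : ∀ μ ∈ Set.Icc μa μb, ∀ β : ℝ, 0 < β → ∀ (x y : Site 2) (σ σ' : Fin 2),
      ∃ Ω : Set ℂ, IsOpen Ω ∧ IsPreconnected Ω ∧ (0 : ℂ) ∈ Ω ∧ (∀ U : ℝ, A β U → ((U : ℝ) : ℂ) ∈ Ω) ∧
        ∃ (L₀ : ℕ) (B : ℝ) (G : ℕ → ℂ → ℂ), (∀ L, L₀ ≤ L → DifferentiableOn ℂ (G L) Ω) ∧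
          (∀ L, L₀ ≤ L → ∀ z ∈ Ω, ‖G L z‖ ≤ B) ∧
          (∀ L, L₀ ≤ L → ∀ U : ℝ, ((U : ℝ) : ℂ) ∈ Ω → G L (U : ℂ) = hubbardThermalTwoPoint β U μ L x y σ σ')) :
    ∀ μ ∈ Set.Icc μa μb, ∀ U β : ℝ, 0 < β → A β U → ∀ (x y : Site 2) (σ σ' : Fin 2), ∃ S : ℂ,
      Tendsto (fun L : ℕ => hubbardThermalTwoPoint β U μ L x y σ σ') atTop (𝓝 S) := by
  intro μ hμ U β hβ hA x y σ σ'
  obtain ⟨Ω, hΩ, hΩc, h0, hadm, L₀, B, G, hd, hB, hagree⟩ := h μ hμ β hβ x y σ σ'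
  exact tendsto_hubbardThermalTwoPoint_of_connected_bound hβ μ x y σ σ' hΩ hΩc h0 hd hB hagree (hadm U hA)

/-- **Crux K1 `H10TwoPointLimit` from the complex sausage** (the Vitali line): if there are `U₀, a > 0` such that for every `μ` in the
analysis window `[-1, -0.15]`, every `β > 0` and all sites/spins the finite-volume two-point functions are, for `L ≥ L₀`, the real traces of
holomorphic functions uniformly bounded on an open preconnected `Ω ∋ 0` containing every admissible real coupling `0 < U ≤ U₀`,
`β ≤ e^{a/U}`, then K1 holds (S0 `MuOfDopingWindow_holds` places `μ(δ)`; the bare corner and Vitali's theorem are in the tree).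
[cite: BenfattoGiulianiMastropietro2006, Thm 1.1 / §2.2 footnote 1] -/
theorem H10TwoPointLimit_of_complexSausage {U₀ a : ℝ} (hU₀ : 0 < U₀) (ha : 0 < a)
    (h : ∀ μ ∈ Set.Icc (-1 : ℝ) (-0.15), ∀ β : ℝ, 0 < β → ∀ (x y : Site 2) (σ σ' : Fin 2),
      ∃ Ω : Set ℂ, IsOpen Ω ∧ IsPreconnected Ω ∧ (0 : ℂ) ∈ Ω ∧
        (∀ U : ℝ, 0 < U → U ≤ U₀ → β ≤ Real.exp (a / U) → ((U : ℝ) : ℂ) ∈ Ω) ∧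
        ∃ (L₀ : ℕ) (B : ℝ) (G : ℕ → ℂ → ℂ), (∀ L, L₀ ≤ L → DifferentiableOn ℂ (G L) Ω) ∧
          (∀ L, L₀ ≤ L → ∀ z ∈ Ω, ‖G L z‖ ≤ B) ∧
          (∀ L, L₀ ≤ L → ∀ U : ℝ, ((U : ℝ) : ℂ) ∈ Ω → G L (U : ℂ) = hubbardThermalTwoPoint β U μ L x y σ σ')) :
    Summit.HubbardSuperconductivity.HubbardSuperconductivity.Theses.KLProgramme.H10TwoPointLimit := by
  have hlim := limit_of_sausage_input (μa := -1) (μb := -0.15)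
    (A := fun β U => 0 < U ∧ U ≤ U₀ ∧ β ≤ Real.exp (a / U))
    (fun μ hμ β hβ x y σ σ' => by
      obtain ⟨Ω, hΩ, hΩc, h0, hadm, L₀, B, G, hd, hB, hagree⟩ := h μ hμ β hβ x y σ σ'
      exact ⟨Ω, hΩ, hΩc, h0, fun U hA => hadm U hA.1 hA.2.1 hA.2.2, L₀, B, G, hd, hB, hagree⟩)
  exact ⟨U₀, a, hU₀, ha, fun δ hδ U β hU hUle hβ hβa x y σ σ' =>
    hlim _ (Summit.HubbardSuperconductivity.HubbardSuperconductivity.Theses.KLProgramme.MuOfDopingWindow_holds δ hδ)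
      U β hβ ⟨hU, hUle, hβa⟩ x y σ σ'⟩

/-- **The rung-R2d leaf `H1TwoPointLimitKLScaleD` from the complex sausage** (admissible = `0 < U ≤ U₀`, `0 < β ≤ e^{c/U²}`): the same
Vitali line serves K1 ∧ K3 at once. [cite: BenfattoGiulianiMastropietro2006, Thm 1.1 / §2.2 footnote 1] -/
theorem leaf_of_complexSausage {U₀ c : ℝ} (hU₀ : 0 < U₀) (hc : 0 < c)
    (h : ∀ μ ∈ Set.Icc (-1 : ℝ) (-0.15), ∀ β : ℝ, 0 < β → ∀ (x y : Site 2) (σ σ' : Fin 2),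
      ∃ Ω : Set ℂ, IsOpen Ω ∧ IsPreconnected Ω ∧ (0 : ℂ) ∈ Ω ∧
        (∀ U : ℝ, 0 < U → U ≤ U₀ → β ≤ Real.exp (c / U ^ 2) → ((U : ℝ) : ℂ) ∈ Ω) ∧
        ∃ (L₀ : ℕ) (B : ℝ) (G : ℕ → ℂ → ℂ), (∀ L, L₀ ≤ L → DifferentiableOn ℂ (G L) Ω) ∧
          (∀ L, L₀ ≤ L → ∀ z ∈ Ω, ‖G L z‖ ≤ B) ∧
          (∀ L, L₀ ≤ L → ∀ U : ℝ, ((U : ℝ) : ℂ) ∈ Ω → G L (U : ℂ) = hubbardThermalTwoPoint β U μ L x y σ σ')) :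
    Summit.HubbardSuperconductivity.HubbardSuperconductivity.Theses.WeakCouplingBCS.H1TwoPointLimitKLScaleD := by
  have hlim := limit_of_sausage_input (μa := -1) (μb := -0.15)
    (A := fun β U => 0 < U ∧ U ≤ U₀ ∧ β ≤ Real.exp (c / U ^ 2))
    (fun μ hμ β hβ x y σ σ' => by
      obtain ⟨Ω, hΩ, hΩc, h0, hadm, L₀, B, G, hd, hB, hagree⟩ := h μ hμ β hβ x y σ σ'
      exact ⟨Ω, hΩ, hΩc, h0, fun U hA => hadm U hA.1 hA.2.1 hA.2.2, L₀, B, G, hd, hB, hagree⟩)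
  exact ⟨U₀, c, hU₀, hc, fun δ hδ U β hU hUle hβ hβc x y σ σ' =>
    hlim _ (Summit.HubbardSuperconductivity.HubbardSuperconductivity.Theses.KLProgramme.MuOfDopingWindow_holds δ hδ)
      U β hβ ⟨hU, hUle, hβc⟩ x y σ σ'⟩

end Summit.HubbardSuperconductivity.HubbardSuperconductivity.Theorems.H10VitaliLine

end
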